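import Summits.Parity.GeneralizedHardyLittlewood.Theses.LiouvilleShiftedTables
import Summits.Parity.GeneralizedHardyLittlewood.Theorems.TableChowla.Negative.TableChowlaEquivalentForms

/-!
# `TableChowla` (stmt-Parity-14270), line `corner-local-box`: load-bearing analysis of `stub_corner`

Negative lemmas for the crux `LiouvilleShiftedTables.TableChowla` (drefute seat on the chosen line
`Cruxes/TableChowla/Lines/corner-local-box.lean`). The line's load-bearing stub `stub_corner` asks, for
every shift `c ≠ 0`, `0 < δ ≤ 1/12`, `K > 0`, eventually in `x` and uniformly for `x^δ ≤ A ≤ x^{1/3+δ}`,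
that every OFF-AXIS IN-BOX CORNER SUM of the shifted Liouville table with gaps `1 ≤ h, k ≤ (log x)^K`,
`𝒞(h,k) = Σ_{a ∈ (⌊A⌋, ⌊2A⌋−h]} Σ_{b ∈ [1, ⌊x/A⌋−k]} λ(ab+c)λ((a+h)b+c)λ(a(b+k)+c)λ((a+h)(b+k)+c)`,
is at most `x/(log x)^K` in absolute value.

* `cornerChowlaStub_iff` — read-back: `CornerChowlaStub` is word for word the registered signature.
* `not_cornerChowlaWithoutShiftNeZero` — the side condition `c ≠ 0` is load-bearing: at `c = 0` every
  corner summand is `λ(a)²λ(a+h)²λ(b)²λ(b+k)² = 1`, so `𝒞(1,1) = (m−1)(m¹¹−1) ≥ x/4` at `x = m¹²`,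
  `A = m`, against the claimed `x/(12 log m)`.
* `not_cornerChowlaWithAxisH`, `not_cornerChowlaWithAxisK` — both gap conditions `1 ≤ h`, `1 ≤ k` are
  load-bearing: on either axis the summand is a product of two squares, `𝒞 = #box` (the in-box form of
  the disprover's `IdeaR1.not_localBoxChowla_r1`).
* `not_cornerBoundFor_one` — the ghost `f ≡ 1` violates the corner bound at every shift: any proof must
  use an arithmetic property of `λ` beyond `|λ| ≤ 1` and complete multiplicativity of `|λ|`.
* Companion file `CornerStubResistance.lean`: `UniformBlockChowla ⟹ CornerChowlaStub` (the stub follows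
  from uniform 4-point Chowla–Elliott for the block's four linear forms, so no cheap kill exists).
[folklore]
-/

namespace Summit.Parity.GeneralizedHardyLittlewood.Theorems.TableChowla.Negative

open Finset Real ArithmeticFunction

noncomputable section

/-! ## The objects of the line -/

/-- The OFF-AXIS IN-BOX CORNER SUM of line `corner-local-box` for a general `f`
(rows `a ∈ (A₁, A₂ − h]`, columns `b ∈ [1, B − k]`; verbatim the shape of `stub_corner`). -/
def cornerBox (f : ℕ → ℝ) (c : ℤ) (h k A₁ A₂ B : ℕ) : ℝ :=
  ∑ a ∈ Ioc A₁ (A₂ - h), ∑ b ∈ Icc 1 (B - k),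
    f (Int.toNat ((a : ℤ) * b + c)) * f (Int.toNat (((a : ℤ) + h) * b + c)) *
      f (Int.toNat ((a : ℤ) * ((b : ℤ) + k) + c)) * f (Int.toNat (((a : ℤ) + h) * ((b : ℤ) + k) + c))

/-- The corner bound of `stub_corner` with `λ` replaced by `f` and its three discrete side conditions
(on the shift `c` and on the two gaps `h`, `k`) as parameters `pc`, `ph`, `pk`. -/
def CornerBoundFor (f : ℕ → ℝ) (pc : ℤ → Prop) (ph pk : ℕ → Prop) : Prop :=
  ∀ c : ℤ, pc c → ∀ δ : ℝ, 0 < δ → δ ≤ 1 / 12 → ∀ K : ℝ, 0 < K → ∃ x₀ : ℝ, ∀ x : ℝ, x₀ ≤ x →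
    ∀ A : ℝ, x ^ δ ≤ A → A ≤ x ^ (1 / 3 + δ) → ∀ h k : ℕ, ph h → (h : ℝ) ≤ Real.log x ^ K →
      pk k → (k : ℝ) ≤ Real.log x ^ K → |cornerBox f c h k ⌊A⌋₊ ⌊2 * A⌋₊ ⌊x / A⌋₊| ≤ x / Real.log x ^ K

/-- `stub_corner` of line `corner-local-box`, by name. -/
def CornerChowlaStub : Prop :=
  CornerBoundFor lam (fun c => c ≠ 0) (fun h => 1 ≤ h) (fun k => 1 ≤ k)

/-- READ-BACK: `CornerChowlaStub` is, word for word, the registered signature of `stub_corner`. -/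
theorem cornerChowlaStub_iff : CornerChowlaStub ↔
    (∀ c : ℤ, c ≠ 0 → ∀ δ : ℝ, 0 < δ → δ ≤ 1 / 12 → ∀ K : ℝ, 0 < K → ∃ x₀ : ℝ,
    ∀ x : ℝ, x₀ ≤ x → ∀ A : ℝ, x ^ δ ≤ A → A ≤ x ^ (1 / 3 + δ) → ∀ h k : ℕ, 1 ≤ h →
      (h : ℝ) ≤ Real.log x ^ K → 1 ≤ k → (k : ℝ) ≤ Real.log x ^ K →
        |∑ a ∈ Finset.Ioc ⌊A⌋₊ (⌊2 * A⌋₊ - h), ∑ b ∈ Finset.Icc 1 (⌊x / A⌋₊ - k),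
          (ArithmeticFunction.liouville (Int.toNat ((a : ℤ) * b + c)) : ℝ) *
            (ArithmeticFunction.liouville (Int.toNat (((a : ℤ) + h) * b + c)) : ℝ) *
            (ArithmeticFunction.liouville (Int.toNat ((a : ℤ) * ((b : ℤ) + k) + c)) : ℝ) *
            (ArithmeticFunction.liouville (Int.toNat (((a : ℤ) + h) * ((b : ℤ) + k) + c)) : ℝ)| ≤
          x / Real.log x ^ K) := Iff.rfl

/-- The stub with the side condition `c ≠ 0` dropped. -/
def CornerChowlaWithoutShiftNeZero : Prop :=
  CornerBoundFor lam (fun _ => True) (fun h => 1 ≤ h) (fun k => 1 ≤ k)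

/-- The stub with the gap condition `1 ≤ h` dropped (the `h = 0` axis allowed). -/
def CornerChowlaWithAxisH : Prop :=
  CornerBoundFor lam (fun c => c ≠ 0) (fun _ => True) (fun k => 1 ≤ k)

/-- The stub with the gap condition `1 ≤ k` dropped (the `k = 0` axis allowed). -/
def CornerChowlaWithAxisK : Prop :=
  CornerBoundFor lam (fun c => c ≠ 0) (fun h => 1 ≤ h) (fun _ => True)

/-! ## Evaluation of constant-sign corners -/

/-- If every summand on the box equals `1`, the corner sum is `#rows' · #cols'`. -/
theorem cornerBox_eq_card {f : ℕ → ℝ} {c : ℤ} {h k A₁ A₂ B : ℕ}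
    (H1 : ∀ a ∈ Ioc A₁ (A₂ - h), ∀ b ∈ Icc 1 (B - k),
      f (Int.toNat ((a : ℤ) * b + c)) * f (Int.toNat (((a : ℤ) + h) * b + c)) *
        f (Int.toNat ((a : ℤ) * ((b : ℤ) + k) + c)) * f (Int.toNat (((a : ℤ) + h) * ((b : ℤ) + k) + c)) = 1) :
    cornerBox f c h k A₁ A₂ B = (((A₂ - h) - A₁ : ℕ) : ℝ) * ((B - k : ℕ) : ℝ) := by
  unfold cornerBox
  have hin : ∀ a ∈ Ioc A₁ (A₂ - h),
      ∑ b ∈ Icc 1 (B - k), f (Int.toNat ((a : ℤ) * b + c)) * f (Int.toNat (((a : ℤ) + h) * b + c)) *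
        f (Int.toNat ((a : ℤ) * ((b : ℤ) + k) + c)) * f (Int.toNat (((a : ℤ) + h) * ((b : ℤ) + k) + c)) =
        ((B - k : ℕ) : ℝ) := by
    intro a ha
    rw [sum_congr rfl fun b hb => H1 a ha b hb, sum_const, Nat.card_Icc, Nat.add_sub_cancel, nsmul_eq_mul,
      mul_one]
  rw [sum_congr rfl hin, sum_const, Nat.card_Ioc, nsmul_eq_mul]

/-- `Int.toNat` is faithful on the natural-number expression `u`. -/
theorem toNat_cast_eq (u : ℕ) (z : ℤ) (hz : z = (u : ℤ)) : Int.toNat z = u := by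
  rw [hz, Int.toNat_natCast]

/-- At `c = 0` every corner summand of the λ-table is `λ(a)²λ(a+h)²λ(b)²λ(b+k)² = 1` (`a, b ≥ 1`). -/
theorem corner_summand_lam_shift_zero {a b : ℕ} (ha : a ≠ 0) (hb : b ≠ 0) (h k : ℕ) :
    lam (Int.toNat ((a : ℤ) * b + 0)) * lam (Int.toNat (((a : ℤ) + h) * b + 0)) *
      lam (Int.toNat ((a : ℤ) * ((b : ℤ) + k) + 0)) * lam (Int.toNat (((a : ℤ) + h) * ((b : ℤ) + k) + 0)) = 1 := by
  rw [toNat_cast_eq (a * b) _ (by push_cast; ring), toNat_cast_eq ((a + h) * b) _ (by push_cast; ring),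
    toNat_cast_eq (a * (b + k)) _ (by push_cast; ring), toNat_cast_eq ((a + h) * (b + k)) _ (by push_cast; ring),
    lam_mul, lam_mul, lam_mul, lam_mul]
  have h1 : lam a ^ 2 = 1 := lam_sq ha
  have h2 : lam b ^ 2 = 1 := lam_sq hb
  have h3 : lam (a + h) ^ 2 = 1 := lam_sq (by omega)
  have h4 : lam (b + k) ^ 2 = 1 := lam_sq (by omega)
  calc lam a * lam b * (lam (a + h) * lam b) * (lam a * lam (b + k)) * (lam (a + h) * lam (b + k))
      = lam a ^ 2 * lam b ^ 2 * lam (a + h) ^ 2 * lam (b + k) ^ 2 := by ring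
    _ = 1 := by rw [h1, h2, h3, h4]; ring

/-- At `c = 0` the corner sum is the full box count. -/
theorem cornerBox_lam_shift_zero (h k A₁ A₂ B : ℕ) :
    cornerBox lam 0 h k A₁ A₂ B = (((A₂ - h) - A₁ : ℕ) : ℝ) * ((B - k : ℕ) : ℝ) :=
  cornerBox_eq_card fun a ha b hb => by
    rw [mem_Ioc] at ha
    rw [mem_Icc] at hb
    exact corner_summand_lam_shift_zero (by omega) (by omega) h k

/-- On the axis `h = 0` (shift `c = 1`) every summand is `λ(ab+1)²·λ(a(b+k)+1)² = 1`. -/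
theorem corner_summand_lam_axisH (a b k : ℕ) :
    lam (Int.toNat ((a : ℤ) * b + 1)) * lam (Int.toNat (((a : ℤ) + (0 : ℕ)) * b + 1)) *
      lam (Int.toNat ((a : ℤ) * ((b : ℤ) + k) + 1)) * lam (Int.toNat (((a : ℤ) + (0 : ℕ)) * ((b : ℤ) + k) + 1)) = 1 := by
  rw [toNat_cast_eq (a * b + 1) ((a : ℤ) * b + 1) (by push_cast; ring),
    toNat_cast_eq (a * b + 1) (((a : ℤ) + (0 : ℕ)) * b + 1) (by push_cast; ring),
    toNat_cast_eq (a * (b + k) + 1) ((a : ℤ) * ((b : ℤ) + k) + 1) (by push_cast; ring),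
    toNat_cast_eq (a * (b + k) + 1) (((a : ℤ) + (0 : ℕ)) * ((b : ℤ) + k) + 1) (by push_cast; ring)]
  have h1 : lam (a * b + 1) ^ 2 = 1 := lam_sq (by omega)
  have h2 : lam (a * (b + k) + 1) ^ 2 = 1 := lam_sq (by omega)
  calc lam (a * b + 1) * lam (a * b + 1) * lam (a * (b + k) + 1) * lam (a * (b + k) + 1)
      = lam (a * b + 1) ^ 2 * lam (a * (b + k) + 1) ^ 2 := by ring
    _ = 1 := by rw [h1, h2]; ring

/-- On the axis `k = 0` (shift `c = 1`) every summand is `λ(ab+1)²·λ((a+h)b+1)² = 1`. -/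
theorem corner_summand_lam_axisK (a b h : ℕ) :
    lam (Int.toNat ((a : ℤ) * b + 1)) * lam (Int.toNat (((a : ℤ) + h) * b + 1)) *
      lam (Int.toNat ((a : ℤ) * ((b : ℤ) + (0 : ℕ)) + 1)) * lam (Int.toNat (((a : ℤ) + h) * ((b : ℤ) + (0 : ℕ)) + 1)) = 1 := by
  rw [toNat_cast_eq (a * b + 1) ((a : ℤ) * b + 1) (by push_cast; ring),
    toNat_cast_eq ((a + h) * b + 1) (((a : ℤ) + h) * b + 1) (by push_cast; ring),
    toNat_cast_eq (a * b + 1) ((a : ℤ) * ((b : ℤ) + (0 : ℕ)) + 1) (by push_cast; ring),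
    toNat_cast_eq ((a + h) * b + 1) (((a : ℤ) + h) * ((b : ℤ) + (0 : ℕ)) + 1) (by push_cast; ring)]
  have h1 : lam (a * b + 1) ^ 2 = 1 := lam_sq (by omega)
  have h2 : lam ((a + h) * b + 1) ^ 2 = 1 := lam_sq (by omega)
  calc lam (a * b + 1) * lam ((a + h) * b + 1) * lam (a * b + 1) * lam ((a + h) * b + 1)
      = lam (a * b + 1) ^ 2 * lam ((a + h) * b + 1) ^ 2 := by ring
    _ = 1 := by rw [h1, h2]; ring

/-! ## The witness scale `x = m¹²`, `A = m` (`δ = 1/12`, `K = 1`) -/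

/-- `⌊m¹²/m⌋₊ = m¹¹`. -/
theorem floor_pow_twelve_div {m : ℕ} (hm : m ≠ 0) : ⌊(m : ℝ) ^ 12 / (m : ℝ)⌋₊ = m ^ 11 := by
  have hm' : (m : ℝ) ≠ 0 := by exact_mod_cast hm
  have : (m : ℝ) ^ 12 / (m : ℝ) = ((m ^ 11 : ℕ) : ℝ) := by
    rw [div_eq_iff hm']
    push_cast
    ring
  rw [this, Nat.floor_natCast]

/-- The gap `1` is admissible at `K = 1`, `x = m¹²`, `m ≥ 2`: `1 ≤ (log m¹²)^1 = 12 log m`. -/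
theorem one_le_log_pow_twelve {m : ℕ} (hm : 2 ≤ m) :
    ((1 : ℕ) : ℝ) ≤ Real.log ((m : ℝ) ^ 12) ^ (1 : ℝ) := by
  rw [Real.rpow_one, Real.log_pow]
  have hm2 : (2 : ℝ) ≤ m := by exact_mod_cast hm
  have hl := Real.log_le_log (by norm_num) hm2
  have := log_two_gt_half
  push_cast
  linarith

/-- The common contradiction: a corner value `P` with `m¹² ≤ 4P` (`m ≥ 2`) violates the claimed bound
`P ≤ m¹²/(log m¹²)^1 = m¹²/(12 log m)`. -/
theorem corner_witness_absurd {m : ℕ} (hm : 2 ≤ m) {P : ℝ} (hP : (m : ℝ) ^ 12 ≤ 4 * P)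
    (h : P ≤ (m : ℝ) ^ 12 / Real.log ((m : ℝ) ^ 12) ^ (1 : ℝ)) : False := by
  rw [Real.rpow_one, Real.log_pow] at h
  have hm2 : (2 : ℝ) ≤ m := by exact_mod_cast hm
  have hpos : (0 : ℝ) < (m : ℝ) ^ 12 := by positivity
  have hPpos : 0 < P := by linarith
  refine absurd_of_le_div hPpos hP (by norm_num) ?_ h
  have hl := Real.log_le_log (by norm_num) hm2
  have := log_two_gt_half
  push_cast
  linarith

/-- Size of the witness boxes: `(m − 1)(m¹¹ − 1) ≥ m¹²/4` for `m ≥ 2` (hence also `m(m¹¹−1)` and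
`(m−1)m¹¹`). -/
theorem witness_box_large {m : ℕ} (hm : 2 ≤ m) :
    (m : ℝ) ^ 12 ≤ 4 * (((m : ℝ) - 1) * ((m : ℝ) ^ 11 - 1)) := by
  have hm2 : (2 : ℝ) ≤ m := by exact_mod_cast hm
  have hm1 : (1 : ℝ) ≤ m := by linarith
  have hpow : (m : ℝ) ≤ (m : ℝ) ^ 11 := le_self_pow₀ hm1 (by norm_num)
  have h1 : (m : ℝ) ≤ 2 * ((m : ℝ) - 1) := by linarith
  have h2 : (m : ℝ) ^ 11 ≤ 2 * ((m : ℝ) ^ 11 - 1) := by linarith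
  have h0 : (0 : ℝ) ≤ (m : ℝ) ^ 11 := by positivity
  calc (m : ℝ) ^ 12 = (m : ℝ) * (m : ℝ) ^ 11 := by ring
    _ ≤ (2 * ((m : ℝ) - 1)) * (2 * ((m : ℝ) ^ 11 - 1)) := mul_le_mul h1 h2 h0 (by linarith)
    _ = 4 * (((m : ℝ) - 1) * ((m : ℝ) ^ 11 - 1)) := by ring

/-- Choice of the witness integer `m ≥ max(x₀, 2)` with all the bookkeeping facts. -/
theorem exists_witness (x₀ : ℝ) : ∃ m : ℕ, 2 ≤ m ∧ x₀ ≤ (m : ℝ) ^ 12 ∧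
    ((m : ℝ) ^ 12) ^ ((1 : ℝ) / 12) ≤ m ∧ (m : ℝ) ≤ ((m : ℝ) ^ 12) ^ ((1 : ℝ) / 3 + 1 / 12) := by
  obtain ⟨m, hm⟩ := exists_nat_ge (max x₀ 2)
  have hm2 : (2 : ℝ) ≤ m := le_trans (le_max_right _ _) hm
  have hmx : x₀ ≤ m := le_trans (le_max_left _ _) hm
  have hm1 : (1 : ℝ) ≤ m := by linarith
  have hm2' : 2 ≤ m := by exact_mod_cast hm2
  have hxx₀ : x₀ ≤ (m : ℝ) ^ 12 := hmx.trans (le_self_pow₀ hm1 (by norm_num))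
  obtain ⟨hw1, hw2⟩ := window_pow (k := 12) (by norm_num) (m := m) (by omega)
  refine ⟨m, hm2', hxx₀, ?_, ?_⟩
  · exact_mod_cast hw1
  · exact_mod_cast hw2

/-! ## The load-bearing refutations -/

/-- **`c ≠ 0` is load-bearing for `stub_corner`.** At `c = 0` (`δ = 1/12`, `K = 1`, `x = m¹²`, `A = m`,
`h = k = 1`) the corner sum is the box count `(m−1)(m¹¹−1) ≥ x/4`, not `≤ x/(12 log m)`. -/
theorem not_cornerChowlaWithoutShiftNeZero : ¬ CornerChowlaWithoutShiftNeZero := by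
  intro hW
  obtain ⟨x₀, hx₀⟩ := hW 0 trivial (1 / 12) (by norm_num) le_rfl 1 one_pos
  obtain ⟨m, hm2, hxx₀, hw1, hw2⟩ := exists_witness x₀
  have hm1 : 1 ≤ m := by omega
  have hlog := one_le_log_pow_twelve hm2
  have key := hx₀ ((m : ℝ) ^ 12) hxx₀ m hw1 hw2 1 1 le_rfl hlog le_rfl hlog
  rw [Nat.floor_natCast, floor_two_mul_natCast, floor_pow_twelve_div (by omega), cornerBox_lam_shift_zero,
    show 2 * m - 1 - m = m - 1 by omega, Nat.cast_sub hm1, Nat.cast_sub (Nat.one_le_pow 11 m (by omega)),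
    Nat.cast_pow, Nat.cast_one] at key
  exact corner_witness_absurd hm2 (witness_box_large hm2) (le_trans (le_abs_self _) key)

/-- **`1 ≤ h` is load-bearing for `stub_corner`** (the `h = 0` axis): at `c = 1`, `h = 0`, `k = 1` every
summand is `λ(ab+1)²λ(a(b+1)+1)² = 1` and the corner sum is `m(m¹¹−1) ≥ x/4`. -/
theorem not_cornerChowlaWithAxisH : ¬ CornerChowlaWithAxisH := by
  intro hW
  obtain ⟨x₀, hx₀⟩ := hW 1 one_ne_zero (1 / 12) (by norm_num) le_rfl 1 one_pos
  obtain ⟨m, hm2, hxx₀, hw1, hw2⟩ := exists_witness x₀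
  have hm1 : 1 ≤ m := by omega
  have hlog := one_le_log_pow_twelve hm2
  have h0 : ((0 : ℕ) : ℝ) ≤ Real.log ((m : ℝ) ^ 12) ^ (1 : ℝ) := le_trans (by norm_num) hlog
  have key := hx₀ ((m : ℝ) ^ 12) hxx₀ m hw1 hw2 0 1 trivial h0 le_rfl hlog
  have hev : cornerBox lam 1 0 1 m (2 * m) (m ^ 11) = (((2 * m - 0) - m : ℕ) : ℝ) * ((m ^ 11 - 1 : ℕ) : ℝ) :=
    cornerBox_eq_card fun a _ b _ => corner_summand_lam_axisH a b 1
  rw [Nat.floor_natCast, floor_two_mul_natCast, floor_pow_twelve_div (by omega), hev,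
    show 2 * m - 0 - m = m by omega, Nat.cast_sub (Nat.one_le_pow 11 m (by omega)), Nat.cast_pow,
    Nat.cast_one] at key
  refine corner_witness_absurd hm2 ?_ (le_trans (le_abs_self _) key)
  have hm2r : (2 : ℝ) ≤ m := by exact_mod_cast hm2
  have h11 : (0 : ℝ) ≤ (m : ℝ) ^ 11 - 1 := by
    have : (1 : ℝ) ≤ (m : ℝ) ^ 11 := one_le_pow₀ (by linarith)
    linarith
  calc (m : ℝ) ^ 12 ≤ 4 * (((m : ℝ) - 1) * ((m : ℝ) ^ 11 - 1)) := witness_box_large hm2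
    _ ≤ 4 * ((m : ℝ) * ((m : ℝ) ^ 11 - 1)) := by nlinarith

/-- **`1 ≤ k` is load-bearing for `stub_corner`** (the `k = 0` axis): at `c = 1`, `h = 1`, `k = 0` every
summand is `λ(ab+1)²λ((a+1)b+1)² = 1` and the corner sum is `(m−1)m¹¹ ≥ x/4`. -/
theorem not_cornerChowlaWithAxisK : ¬ CornerChowlaWithAxisK := by
  intro hW
  obtain ⟨x₀, hx₀⟩ := hW 1 one_ne_zero (1 / 12) (by norm_num) le_rfl 1 one_pos
  obtain ⟨m, hm2, hxx₀, hw1, hw2⟩ := exists_witness x₀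
  have hm1 : 1 ≤ m := by omega
  have hlog := one_le_log_pow_twelve hm2
  have h0 : ((0 : ℕ) : ℝ) ≤ Real.log ((m : ℝ) ^ 12) ^ (1 : ℝ) := le_trans (by norm_num) hlog
  have key := hx₀ ((m : ℝ) ^ 12) hxx₀ m hw1 hw2 1 0 le_rfl hlog trivial h0
  have hev : cornerBox lam 1 1 0 m (2 * m) (m ^ 11) = (((2 * m - 1) - m : ℕ) : ℝ) * ((m ^ 11 - 0 : ℕ) : ℝ) :=
    cornerBox_eq_card fun a _ b _ => corner_summand_lam_axisK a b 1
  rw [Nat.floor_natCast, floor_two_mul_natCast, floor_pow_twelve_div (by omega), hev,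
    show 2 * m - 1 - m = m - 1 by omega, Nat.sub_zero, Nat.cast_sub hm1, Nat.cast_pow, Nat.cast_one] at key
  refine corner_witness_absurd hm2 ?_ (le_trans (le_abs_self _) key)
  have hm2r : (2 : ℝ) ≤ m := by exact_mod_cast hm2
  have h11 : (0 : ℝ) ≤ (m : ℝ) - 1 := by linarith
  calc (m : ℝ) ^ 12 ≤ 4 * (((m : ℝ) - 1) * ((m : ℝ) ^ 11 - 1)) := witness_box_large hm2
    _ ≤ 4 * (((m : ℝ) - 1) * (m : ℝ) ^ 11) := by nlinarith

/-- **The ghost `f ≡ 1` violates the corner bound at every shift** (here `c = 1`, `h = k = 1`): the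
corner sum is the box count. Any proof of `stub_corner` uses more about `λ` than `|λ| ≤ 1`. -/
theorem not_cornerBoundFor_one :
    ¬ CornerBoundFor (fun _ => (1 : ℝ)) (fun c => c ≠ 0) (fun h => 1 ≤ h) (fun k => 1 ≤ k) := by
  intro hW
  obtain ⟨x₀, hx₀⟩ := hW 1 one_ne_zero (1 / 12) (by norm_num) le_rfl 1 one_pos
  obtain ⟨m, hm2, hxx₀, hw1, hw2⟩ := exists_witness x₀
  have hm1 : 1 ≤ m := by omega
  have hlog := one_le_log_pow_twelve hm2
  have key := hx₀ ((m : ℝ) ^ 12) hxx₀ m hw1 hw2 1 1 le_rfl hlog le_rfl hlog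
  have hev : cornerBox (fun _ => (1 : ℝ)) 1 1 1 m (2 * m) (m ^ 11) =
      (((2 * m - 1) - m : ℕ) : ℝ) * ((m ^ 11 - 1 : ℕ) : ℝ) :=
    cornerBox_eq_card fun a _ b _ => by ring
  rw [Nat.floor_natCast, floor_two_mul_natCast, floor_pow_twelve_div (by omega), hev,
    show 2 * m - 1 - m = m - 1 by omega, Nat.cast_sub hm1, Nat.cast_sub (Nat.one_le_pow 11 m (by omega)),
    Nat.cast_pow, Nat.cast_one] at key
  exact corner_witness_absurd hm2 (witness_box_large hm2) (le_trans (le_abs_self _) key)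

end

end Summit.Parity.GeneralizedHardyLittlewood.Theorems.TableChowla.Negative
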